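import Literature.IUT.HodgeTheaters.PMBaseKit

/-!
# [IUTchI] §6, Definition 6.1 (iii), (iv): `𝒟`-prime-strips, `Aut_+(†𝔇)`, `+`-full poly-isomorphisms

Mochizuki, *Inter-universal Teichmüller theory I*, §6, Definition 6.1 (iii) p. 157 and (iv) p. 157,
kurims manuscript (May 2020) ([IUTchI] Def 6.1 (iii)-(iv) p.157) [claim: Mochizuki2012, status: disputed], over the base
interface `PMBaseKit` of `PMBaseKit.lean`:

* `𝒟`-prime-strips `†𝔇 = {†𝒟_v}_{v ∈ 𝕍}` and their isomorphisms ([IUTchI] Def 4.1 (i), (iv) pp. 95–96;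
  minimal local version, TODO-merge:abc-iut-L5-t3), `Aut(†𝔇) = ∏_v Aut(†𝒟_v)`;
* Def 6.1 (iii): `Aut_+(†𝔇)` "[automorphisms each of whose components is positive]", `Aut^α(†𝔇)` for
  `α ∈ {±1}^𝕍` "[… positive if `α(v) = +1` and negative if `α(v) = −1`]";
* Def 6.1 (iv): `+`-full poly-isomorphisms `†𝒟_v ⥲ ‡𝒟_v` (the `Aut_+(‡𝒟_v)`-orbit of an isomorphism;
  "[or, equivalently, `Aut_+(†𝒟_v)`-]" PROVED: `mem_plusFullPolyIso_iff_pre`), the positive and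
  negative ones when `†𝔇 = ‡𝔇`, "there are precisely two `+`-full poly-isomorphisms `†𝒟_v ⥲ ‡𝒟_v`"
  PROVED from the interface (`preciselyTwoPlusFullPolyAut`), `+`-full poly-isomorphisms of
  `𝒟`-prime-strips, the `α`-signed ones, and "the set of `+`-full poly-isomorphisms `†𝔇 ⥲ ‡𝔇` is in
  natural bijective correspondence with `{±1}^𝕍`" as the named statement
  `DStrip.PlusFullPolyAutEquivSigns`; capsule-`+`-full poly-morphisms are with the bridges
  (Def 6.4) in `PMBaseBridges.lean`.
-/

namespace Literature.IUT.HodgeTheaters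

open CategoryTheory

universe u

namespace PMBaseKit

variable {l : ℕ} (K : PMBaseKit.{u} l)

/-! ### `𝒟`-prime-strips (Def 4.1 (i), (iv); TODO-merge:abc-iut-L5-t3) and Def 6.1 (iii) for them -/

/-- A **`𝒟`-prime-strip** `†𝔇 = {†𝒟_v}_{v ∈ 𝕍}`: "a collection of data … (a) if `v ∈ 𝕍^non`, then
`†𝒟_v` is a category which admits an equivalence of categories `†𝒟_v ⥲ 𝒟_v` …; (b) if `v ∈ 𝕍^arc`,
then `†𝒟_v` is an Aut-holomorphic orbispace such that there exists an isomorphism `†𝒟_v ⥲ 𝒟_v`"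
([IUTchI] Def 4.1 (i) p. 95). Minimal local version pending abc-iut-L5-t3's §4 file
(TODO-merge:abc-iut-L5-t3). ([IUTchI] Def 4.1 (i) p.95) [claim: Mochizuki2012, status: disputed] -/
structure DStrip where
  /-- the component `†𝒟_v` at `v` -/
  obj : ∀ v : K.V, K.Amb v
  /-- each component is an isomorph of the model `𝒟_v` -/
  isLocal : ∀ v, K.IsLocal v (obj v)

namespace DStrip

variable {K}

/-- The model `𝒟`-prime-strip `{𝒟_v}_{v ∈ 𝕍}` ("the tautological `𝒟`-prime-strip", [IUTchI] Examples
4.3 (iv), 4.4 (ii), 6.2 (i) p. 160). ([IUTchI] Ex 6.2 (i) p.160) [claim: Mochizuki2012, status: disputed] -/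
abbrev model (K : PMBaseKit.{u} l) : K.DStrip := ⟨K.model, K.isLocal_model⟩

/-- An isomorphism of `𝒟`-prime-strips: "a collection of morphisms, indexed by `𝕍`, between the
various constituent objects of the prime-strips" ([IUTchI] Def 4.1 (iv) p. 96), here isomorphisms
(TODO-merge:abc-iut-L5-t3). ([IUTchI] Def 4.1 (iv) p.96) [claim: Mochizuki2012, status: disputed] -/
abbrev Iso (D₁ D₂ : K.DStrip) : Type u := ∀ v, D₁.obj v ≅ D₂.obj v

/-- `Aut(†𝔇)`: automorphisms of a `𝒟`-prime-strip act componentwise, so `Aut(†𝔇) = ∏_v Aut(†𝒟_v)`.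
([IUTchI] Def 4.1 (iv) p.96) [claim: Mochizuki2012, status: disputed] -/
abbrev AutGroup (D : K.DStrip) : Type u := ∀ v, Aut (D.obj v)

/-- `Aut_+(†𝔇) ⊆ Aut(†𝔇)`, "the subgroup of positive automorphisms [i.e., automorphisms each of
whose components, for `v ∈ 𝕍`, is positive]" ([IUTchI] Def 6.1 (iii) p. 157).
([IUTchI] Def 6.1 (iii) p.157) [claim: Mochizuki2012, status: disputed] -/
def autPlus (D : K.DStrip) : Subgroup D.AutGroup :=
  Subgroup.pi Set.univ fun v => K.autPlus v (D.obj v)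

/-- Membership in `Aut_+(†𝔇)`: every component is positive.
([IUTchI] Def 6.1 (iii) p.157) [claim: Mochizuki2012, status: disputed] -/
theorem mem_autPlus_iff (D : K.DStrip) (α : D.AutGroup) :
    α ∈ D.autPlus ↔ ∀ v, α v ∈ K.autPlus v (D.obj v) := by
  simp [autPlus, Subgroup.mem_pi]

/-- `Aut^α(†𝔇) ⊆ Aut(†𝔇)` for `α ∈ {±1}^𝕍`, "the subset of `α`-signed automorphisms [i.e.,
automorphisms each of whose components, for `v ∈ 𝕍`, is positive if `α(v) = +1` and negative if
`α(v) = −1`]" ([IUTchI] Def 6.1 (iii) p. 157). ([IUTchI] Def 6.1 (iii) p.157) [claim: Mochizuki2012, status: disputed] -/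
def autSigned (D : K.DStrip) (α : K.V → ℤˣ) : Set D.AutGroup :=
  {β | ∀ v, (α v = 1 → β v ∈ K.autPlus v (D.obj v)) ∧ (α v = -1 → β v ∈ K.autMinus v (D.obj v))}

/-- `Aut^{(+1,…,+1)}(†𝔇) = Aut_+(†𝔇)`. ([IUTchI] Def 6.1 (iii) p.157) [claim: Mochizuki2012, status: disputed] -/
theorem autSigned_one (D : K.DStrip) : D.autSigned (fun _ => 1) = D.autPlus := by
  ext β
  have h1 : ((1 : ℤˣ) = -1) ↔ False := ⟨fun h => absurd h (by decide), False.elim⟩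
  simp [autSigned, mem_autPlus_iff, h1]

end DStrip

/-! ### Def 6.1 (iv): `+`-full poly-isomorphisms -/

/-- A **`+`-full poly-isomorphism** `†𝒟_v ⥲ ‡𝒟_v`: "any poly-isomorphism obtained as the
`Aut_+(†𝒟_v)`- [or, equivalently, `Aut_+(‡𝒟_v)`-] orbit of an isomorphism `†𝒟_v ⥲ ‡𝒟_v`" ([IUTchI]
Def 6.1 (iv) p. 157); poly-isomorphism = set of isomorphisms (§0 p. 33). Here: the
`Aut_+(‡𝒟_v)`-orbit under post-composition. ([IUTchI] Def 6.1 (iv) p.157) [claim: Mochizuki2012, status: disputed] -/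
def IsPlusFullPolyIso {v : K.V} {X Y : K.Amb v} (P : Set (X ≅ Y)) : Prop :=
  ∃ φ : X ≅ Y, P = {ψ | ∃ a ∈ K.autPlus v Y, ψ = φ ≪≫ a}

/-- The `+`-full poly-isomorphism through a given isomorphism `φ`: its `Aut_+(‡𝒟_v)`-orbit.
([IUTchI] Def 6.1 (iv) p.157) [claim: Mochizuki2012, status: disputed] -/
def plusFullPolyIso {v : K.V} {X Y : K.Amb v} (φ : X ≅ Y) : Set (X ≅ Y) :=
  {ψ | ∃ a ∈ K.autPlus v Y, ψ = φ ≪≫ a}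

/-- The orbit of `φ` is a `+`-full poly-isomorphism. ([IUTchI] Def 6.1 (iv) p.157) [claim: Mochizuki2012, status: disputed] -/
theorem isPlusFullPolyIso_plusFullPolyIso {v : K.V} {X Y : K.Amb v} (φ : X ≅ Y) :
    K.IsPlusFullPolyIso (K.plusFullPolyIso φ) := ⟨φ, rfl⟩

/-- `φ` lies in its own `+`-full poly-isomorphism. ([IUTchI] Def 6.1 (iv) p.157) [claim: Mochizuki2012, status: disputed] -/
theorem mem_plusFullPolyIso_self {v : K.V} {X Y : K.Amb v} (φ : X ≅ Y) : φ ∈ K.plusFullPolyIso φ :=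
  ⟨1, one_mem _, by change φ = φ ≪≫ Iso.refl Y; simp⟩

/-- "[or, equivalently, `Aut_+(†𝒟_v)`-] orbit" ([IUTchI] Def 6.1 (iv) p. 157): membership in the
`Aut_+(‡𝒟_v)`-orbit of `φ` is the same as in its `Aut_+(†𝒟_v)`-orbit under pre-composition, because
conjugation by `φ` carries `Aut_+(†𝒟_v)` onto `Aut_+(‡𝒟_v)` (functoriality of `LabCusp^±`).
([IUTchI] Def 6.1 (iv) p.157) [claim: Mochizuki2012, status: disputed] -/
theorem mem_plusFullPolyIso_iff_pre {v : K.V} {X Y : K.Amb v} (φ ψ : X ≅ Y) :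
    ψ ∈ K.plusFullPolyIso φ ↔ ∃ b ∈ K.autPlus v X, ψ = b ≪≫ φ := by
  constructor
  · rintro ⟨a, ha, rfl⟩
    refine ⟨φ ≪≫ a ≪≫ φ.symm, ?_, by simp⟩
    rw [mem_autPlus_iff] at ha ⊢
    rw [K.labMap_trans, K.labMap_trans, ha]
    ext x
    simp [← K.labMap_trans, K.labMap_refl]
  · rintro ⟨b, hb, rfl⟩
    refine ⟨φ.symm ≪≫ b ≪≫ φ, ?_, by simp⟩
    rw [mem_autPlus_iff] at hb ⊢
    rw [K.labMap_trans, K.labMap_trans, hb]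
    ext x
    simp [← K.labMap_trans, K.labMap_refl]

/-- When `†𝔇 = ‡𝔇`: "the `+`-full poly-isomorphism determined by the identity isomorphism, which we
shall refer to as positive" ([IUTchI] Def 6.1 (iv) p. 157) — it is `Aut_+(†𝒟_v)` itself.
([IUTchI] Def 6.1 (iv) p.157) [claim: Mochizuki2012, status: disputed] -/
def positivePolyAut (v : K.V) (X : K.Amb v) : Set (X ≅ X) := K.plusFullPolyIso (Iso.refl X)

/-- The positive `+`-full poly-automorphism is the set `Aut_+(†𝒟_v)`.
([IUTchI] Def 6.1 (iv) p.157) [claim: Mochizuki2012, status: disputed] -/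
theorem mem_positivePolyAut_iff {v : K.V} {X : K.Amb v} (ψ : X ≅ X) :
    ψ ∈ K.positivePolyAut v X ↔ K.labMap v ψ = Equiv.refl _ := by
  constructor
  · rintro ⟨a, ha, rfl⟩
    rw [Iso.refl_trans]
    exact (K.mem_autPlus_iff a).mp ha
  · intro h
    exact ⟨ψ, (K.mem_autPlus_iff _).mpr h, by simp⟩

/-- When `†𝔇 = ‡𝔇`: "the unique non-positive `+`-full poly-isomorphism, which we shall refer to as
negative" ([IUTchI] Def 6.1 (iv) p. 157) — the orbit of any negative automorphism, i.e. the set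
`Aut_−(†𝒟_v)` (that all negative automorphisms give the same orbit is `PreciselyTwoPlusFullPolyAut`).
([IUTchI] Def 6.1 (iv) p.157) [claim: Mochizuki2012, status: disputed] -/
def negativePolyAut (v : K.V) (X : K.Amb v) : Set (X ≅ X) := {ψ | K.labMap v ψ ≠ Equiv.refl _}

/-- The negative `+`-full poly-automorphism is the set `Aut_−(†𝒟_v)`.
([IUTchI] Def 6.1 (iv) p.157) [claim: Mochizuki2012, status: disputed] -/
theorem mem_negativePolyAut_iff {v : K.V} {X : K.Amb v} (ψ : Aut X) :
    ψ ∈ K.negativePolyAut v X ↔ ψ ∈ K.autMinus v X := by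
  rw [autMinus, Set.mem_compl_iff, SetLike.mem_coe, mem_autPlus_iff]
  rfl

/-- "In particular, if `†𝔇 = ‡𝔇`, then there are precisely two `+`-full poly-isomorphisms
`†𝒟_v ⥲ ‡𝒟_v`" ([IUTchI] Def 6.1 (iv) p. 157), as a named statement: every `+`-full
poly-automorphism is the positive or the negative one, and these differ.
([IUTchI] Def 6.1 (iv) p.157) [claim: Mochizuki2012, status: disputed] -/
def PreciselyTwoPlusFullPolyAut (v : K.V) (X : K.Amb v) : Prop :=
  (∀ P : Set (X ≅ X), K.IsPlusFullPolyIso P → P = K.positivePolyAut v X ∨ P = K.negativePolyAut v X) ∧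
    K.IsPlusFullPolyIso (K.negativePolyAut v X) ∧ K.positivePolyAut v X ≠ K.negativePolyAut v X

/-! #### The action of `Aut(†𝒟_v)` on `LabCusp^±(†𝒟_v)` takes exactly the two values `±1` -/

section TwoValues

variable {K}

/-- The permutation of `LabCusp^±(†𝒟_v)` given by `z ↦ −z` in a chart of its `𝔽_l^±`-group structure
(independent of the chart): how a negative automorphism acts ([IUTchI] Def 6.1 (iii) p. 157).
([IUTchI] Def 6.1 (iii) p.157) [claim: Mochizuki2012, status: disputed] -/
noncomputable def labNeg {v : K.V} {X : K.Amb v} (hX : K.IsLocal v X) :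
    Equiv.Perm (K.LabCuspPM v X) :=
  (K.labPM v X hX).chart₀.trans ((signPerm l (-1)).trans (K.labPM v X hX).chart₀.symm)

/-- `LabCusp^±` of an inverse isomorphism is the inverse bijection.
([IUTchI] Def 6.1 (iii) p.157) [claim: Mochizuki2012, status: disputed] -/
theorem labMap_symm {v : K.V} {X Y : K.Amb v} (φ : X ≅ Y) :
    K.labMap v φ.symm = (K.labMap v φ).symm := by
  have h := K.labMap_trans v φ φ.symm
  rw [Iso.self_symm_id, K.labMap_refl] at h
  ext y
  have h' := congrArg (fun e => e ((K.labMap v φ).symm y)) h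
  simpa using h'.symm

/-- Every automorphism of an isomorph `†𝒟_v` acts on `LabCusp^±(†𝒟_v)` either trivially or by
`z ↦ −z` ("natural surjection `Aut(†𝒟_v) ↠ {±1}` … by considering the induced automorphism of
`LabCusp^±(†𝒟_v)`", [IUTchI] Def 6.1 (iii) p. 157). ([IUTchI] Def 6.1 (iii) p.157) [claim: Mochizuki2012, status: disputed] -/
theorem labMap_eq_refl_or_labNeg {v : K.V} {X : K.Amb v} (hX : K.IsLocal v X) (α : Aut X) :
    K.labMap v α = Equiv.refl _ ∨ K.labMap v α = labNeg hX := by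
  set S := K.labPM v X hX
  obtain ⟨ε, hε⟩ := S.exists_sign_of_mem S.chart₀_mem (K.labMap_charts v hX hX α _ S.chart₀_mem)
  have key : K.labMap v α = (S.chart₀.trans (signPerm l ε)).trans S.chart₀.symm := by
    rw [← hε]; ext x; simp
  rcases Int.units_eq_one_or ε with rfl | rfl
  · left; rw [key]; ext x; simp
  · right; rw [key]; rfl

/-- The permutation `z ↦ −z` of `LabCusp^±(†𝒟_v)` is not the identity (a consequence of the
interface's "natural surjection `Aut(†𝒟_v) ↠ {±1}`"). ([IUTchI] Def 6.1 (iii) p.157) [claim: Mochizuki2012, status: disputed] -/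
theorem labNeg_ne_refl {v : K.V} {X : K.Amb v} (hX : K.IsLocal v X) : labNeg hX ≠ Equiv.refl _ := by
  obtain ⟨β, hβ⟩ := K.exists_negative v X hX
  rcases labMap_eq_refl_or_labNeg hX β with h | h
  · exact absurd h hβ
  · rw [← h]; exact hβ

/-- An automorphism acts nontrivially on `LabCusp^±(†𝒟_v)` iff it acts by `z ↦ −z`, i.e. negative
automorphisms are exactly those acting by `z ↦ −z`. ([IUTchI] Def 6.1 (iii) p.157) [claim: Mochizuki2012, status: disputed] -/
theorem labMap_ne_refl_iff {v : K.V} {X : K.Amb v} (hX : K.IsLocal v X) (α : X ≅ X) :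
    K.labMap v α ≠ Equiv.refl _ ↔ K.labMap v α = labNeg hX := by
  rcases labMap_eq_refl_or_labNeg hX α with h | h
  · rw [h]; exact ⟨fun h' => absurd rfl h', fun h' => absurd h'.symm (labNeg_ne_refl hX)⟩
  · rw [h]; exact ⟨fun _ => rfl, fun _ => labNeg_ne_refl hX⟩

/-- The negative `+`-full poly-automorphism is the `Aut_+`-orbit of any negative automorphism.
([IUTchI] Def 6.1 (iv) p.157) [claim: Mochizuki2012, status: disputed] -/
theorem negativePolyAut_eq_plusFullPolyIso {v : K.V} {X : K.Amb v} (hX : K.IsLocal v X) {α₀ : X ≅ X}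
    (hα₀ : K.labMap v α₀ = labNeg hX) : K.negativePolyAut v X = K.plusFullPolyIso α₀ := by
  ext ψ
  change K.labMap v ψ ≠ Equiv.refl _ ↔ _
  rw [labMap_ne_refl_iff hX]
  constructor
  · intro h
    refine ⟨α₀.symm ≪≫ ψ, ?_, by simp⟩
    rw [mem_autPlus_iff, K.labMap_trans, labMap_symm, hα₀, h]
    exact Equiv.symm_trans_self _
  · rintro ⟨a, ha, rfl⟩
    rw [mem_autPlus_iff] at ha
    rw [K.labMap_trans, ha, hα₀]
    exact Equiv.trans_refl _

/-- The positive `+`-full poly-automorphism is the `Aut_+`-orbit of any positive automorphism.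
([IUTchI] Def 6.1 (iv) p.157) [claim: Mochizuki2012, status: disputed] -/
theorem positivePolyAut_eq_plusFullPolyIso {v : K.V} {X : K.Amb v} {φ : X ≅ X}
    (hφ : K.labMap v φ = Equiv.refl _) : K.positivePolyAut v X = K.plusFullPolyIso φ := by
  ext ψ
  rw [mem_positivePolyAut_iff]
  constructor
  · intro h
    refine ⟨φ.symm ≪≫ ψ, ?_, by simp⟩
    rw [mem_autPlus_iff, K.labMap_trans, labMap_symm, hφ, h]
    rfl
  · rintro ⟨a, ha, rfl⟩
    rw [mem_autPlus_iff] at ha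
    rw [K.labMap_trans, ha, hφ]
    rfl

/-- **"In particular, if `†𝔇 = ‡𝔇`, then there are precisely two `+`-full poly-isomorphisms
`†𝒟_v ⥲ ‡𝒟_v`"** ([IUTchI] Def 6.1 (iv) p. 157) — PROVED from the interface.
([IUTchI] Def 6.1 (iv) p.157) [claim: Mochizuki2012, status: disputed] -/
theorem preciselyTwoPlusFullPolyAut {v : K.V} {X : K.Amb v} (hX : K.IsLocal v X) :
    K.PreciselyTwoPlusFullPolyAut v X := by
  obtain ⟨α₀, hα₀⟩ := K.exists_negative v X hX
  refine ⟨fun P hP => ?_,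
    ⟨α₀, negativePolyAut_eq_plusFullPolyIso hX ((labMap_ne_refl_iff hX _).mp hα₀)⟩, fun heq => ?_⟩
  · obtain ⟨φ, rfl⟩ := hP
    by_cases hφ : K.labMap v φ = Equiv.refl _
    · exact Or.inl (positivePolyAut_eq_plusFullPolyIso hφ).symm
    · exact Or.inr (negativePolyAut_eq_plusFullPolyIso hX ((labMap_ne_refl_iff hX φ).mp hφ)).symm
  · have h1 : Iso.refl X ∈ K.positivePolyAut v X := K.mem_plusFullPolyIso_self _
    rw [heq] at h1
    exact h1 (K.labMap_refl v X)

end TwoValues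

section DStripPoly

variable {K}

/-- A `+`-full poly-isomorphism of `𝒟`-prime-strips `†𝔇 ⥲ ‡𝔇`: "any poly-isomorphism obtained as
the `Aut_+(†𝔇)`- [or, equivalently, `Aut_+(‡𝔇)`-] orbit of an isomorphism `†𝔇 ⥲ ‡𝔇`" ([IUTchI] Def
6.1 (iv) p. 157). ([IUTchI] Def 6.1 (iv) p.157) [claim: Mochizuki2012, status: disputed] -/
def DStrip.IsPlusFullPolyIso {D₁ D₂ : K.DStrip} (P : Set (D₁.Iso D₂)) : Prop :=
  ∃ φ : D₁.Iso D₂, P = {ψ | ∃ a ∈ D₂.autPlus, ψ = fun v => φ v ≪≫ a v}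

/-- The `+`-full poly-isomorphism of `𝒟`-prime-strips through `φ`.
([IUTchI] Def 6.1 (iv) p.157) [claim: Mochizuki2012, status: disputed] -/
def DStrip.plusFullPolyIso {D₁ D₂ : K.DStrip} (φ : D₁.Iso D₂) : Set (D₁.Iso D₂) :=
  {ψ | ∃ a ∈ D₂.autPlus, ψ = fun v => φ v ≪≫ a v}

/-- "the `+`-full poly-isomorphism `†𝔇 ⥲ ‡𝔇` that corresponds to `α ∈ {±1}^𝕍`, the `α`-signed
`+`-full poly-isomorphism", for `†𝔇 = ‡𝔇` ([IUTchI] Def 6.1 (iv) p. 157): the set `Aut^α(†𝔇)`.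
([IUTchI] Def 6.1 (iv) p.157) [claim: Mochizuki2012, status: disputed] -/
def DStrip.signedPolyAut (D : K.DStrip) (α : K.V → ℤˣ) : Set (D.Iso D) := D.autSigned α

/-- "if `†𝔇 = ‡𝔇`, then the set of `+`-full poly-isomorphisms `†𝔇 ⥲ ‡𝔇` is in natural bijective
correspondence with the set `{±1}^𝕍`" ([IUTchI] Def 6.1 (iv) p. 157), as a named statement:
`α ↦ Aut^α(†𝔇)` is a bijection from `{±1}^𝕍` onto the `+`-full poly-automorphisms of `†𝔇`.
([IUTchI] Def 6.1 (iv) p.157) [claim: Mochizuki2012, status: disputed] -/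
def DStrip.PlusFullPolyAutEquivSigns (D : K.DStrip) : Prop :=
  (∀ α : K.V → ℤˣ, DStrip.IsPlusFullPolyIso (D.signedPolyAut α)) ∧
    Function.Injective D.signedPolyAut ∧
    ∀ P : Set (D.Iso D), DStrip.IsPlusFullPolyIso P → ∃ α, P = D.signedPolyAut α

end DStripPoly

/-! ### Def 6.1 (v), last sentence, and Remark 6.1.1 (parametrised by `𝕍(K)`) -/

/-- **Def 6.1 (v), last sentence**: "`𝕍^± := Aut_±(𝒟^{⊚±}) · 𝕍 = Aut_csp(𝒟^{⊚±}) · 𝕍 ⊆ 𝕍(K)` … one verifies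
immediately that the subgroup `Aut_±(𝒟^{⊚±}) ⊆ Aut(𝒟^{⊚±}) ≅ Aut(X_K)` may be identified with the subgroup of
`Aut(X_K)` that stabilizes `𝕍^±`" ([IUTchI] Def 6.1 (v) p. 158), over the set `𝕍(K)` with its
`Aut(𝒟^{⊚±})`-action and the section `𝕍 ⊆ 𝕍(K)` of [IUTchI] Def 3.1 (abc-iut-L5-t2) as parameters: the two
orbit-sets coincide and `Aut_±` is the stabiliser — named statement.
([IUTchI] Def 6.1 (v) p.158) [claim: Mochizuki2012, status: disputed] -/
def VpmSpec (VK : Type*) [MulAction (Aut K.gModel) VK] (sect : K.V → VK) : Prop :=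
  {x : VK | ∃ α ∈ K.autPMg K.gModel, ∃ v, x = α • sect v} =
      {x : VK | ∃ α ∈ K.autCsp K.gModel, ∃ v, x = α • sect v} ∧
    ∀ α : Aut K.gModel, α ∈ K.autPMg K.gModel ↔
      ∀ x ∈ {x : VK | ∃ β ∈ K.autPMg K.gModel, ∃ v, x = β • sect v},
        α • x ∈ {x : VK | ∃ β ∈ K.autPMg K.gModel, ∃ v, x = β • sect v}

/-- **Rmk 6.1.1**: "in the notation of Example 4.3, (i); Definition 6.1, (v), it is not difficult to
verify [cf. Remark 3.1.2, (i)] that `𝕍^± = 𝕍^{±un} (⊆ 𝕍(K))`" ([IUTchI] Rmk 6.1.1 p. 159), with `𝕍^{±un}` of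
Example 4.3 (i) (abc-iut-L5-t3) as a parameter — named statement. ([IUTchI] Rmk 6.1.1 p.159) [claim: Mochizuki2012, status: disputed] -/
def VpmEqVpmun (VK : Type*) [MulAction (Aut K.gModel) VK] (sect : K.V → VK) (Vpmun : Set VK) : Prop :=
  {x : VK | ∃ α ∈ K.autPMg K.gModel, ∃ v, x = α • sect v} = Vpmun

end PMBaseKit

end Literature.IUT.HodgeTheaters
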